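import Literature.Analysis.FluidPDE.SereginSverakAxisymmetric
import HarnessLib

/-!
# Seregin–Šverák 2009, Lemma 3.6 and Theorem 3.2 (the `C/|x'|` variant)

G. Seregin, V. Šverák, *On Type I singularities of the local axi-symmetric solutions of the
Navier–Stokes equations*, Comm. PDE 34 (2009), 171–201 = arXiv:0804.1803 (page and label
references are to the arXiv version). Companion of
`Literature.Analysis.FluidPDE.SereginSverakAxisymmetric` (vocabulary of §3, Lemma 3.5, Prop. 3.7,
the blow-up alternative `BlowupAlternative` of §4, assembly of Thm. 3.1) and of
`Literature.Analysis.FluidPDE.SereginSverakBlowup` (the blow-up alternative `BlowupAlternativeTypeI`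
under the Type I bound, and the two analytic inputs of §4). This file records the second theorem
proved in §4:

> **Theorem 3.2.** Assume that functions `v ∈ L₃(Q)` and `q ∈ L_{3/2}(Q)` are an axially
> symmetric weak solution to the Navier–Stokes equations in `Q`. Let, in addition,
> (r2) `v ∈ L_∞(𝒞 × ]-1, -a²[)` for each `0 < a < 1` and (r4) `|v(x,t)| ≤ C/|x'|` for almost all
> points `z = (x,t) ∈ Q` with some positive constant `C`. Then `z = 0` is a regular point of `v`.

> **Lemma 3.6.** Under assumptions of Theorem 3.2, estimate (as4)
> [`A(z_b,r;v) + E(z_b,r;v) + C(z_b,r;v) + D(z_b,r;q) ≤ C₁ < +∞` for all `z_b = (b e₃, 0)`,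
> `|b| ≤ 1/4`, `0 < r < 1/4`] is valid as well with constant `C₁` depending only on the constant
> `C` in (r4), `‖v‖_{L₃(Q)}`, and `‖q‖_{L_{3/2}(Q)}`.

and §4 (p. 11): "Using Lemmata 3.3, 3.5, 3.6, Remark 3.4, Proposition 3.7 and scaling arguments,
we may assume (p1) `sup_{0<r≤1} (A+E+C+D)(0,r) < ∞`, (p2) `sup_Q |x'||v| < ∞` …", the blow-up
(p3)–(p11) at running maxima, and "as it was shown in [KNSS], such a solution must be
identically zero … Theorems 3.1 and 3.2 are proved."

## Rendering of §4 for Theorem 3.2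

§4 is ONE blow-up argument serving Thm. 3.1 and Thm. 3.2 alike; the tree vendors it once, as the
parent file's named fact `BlowupAlternative` (hypotheses: the standing assumptions of §3 with axial
symmetry, (r2), the origin-centred local (p1), the local (p2) `|x'| ‖u‖ ≤ A₂` a.e. on some `Q(ρ)`,
"`z = 0` singular"; conclusion: a non-zero axisymmetric bounded ancient weak solution with
`|y'| ‖w‖ ≤ A₂`, in the a.e. forms consumed by `KNSS2009_liouville_bound_C_over_r`). Under the
hypotheses of Thm. 3.2 the local (p1) at the origin is Lemma 3.6 at `z_b = 0` and the local (p2)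
is (r4) itself (`ρ = 1`), so Thm. 3.2 is assembled — as the last two sentences of §4 do — from
Lemma 3.6, `BlowupAlternative` and KNSS 2009, Thm. 5.3: `isRegularAtOrigin_of_axisDecay`.

* `ScaledEnergyBoundOfAxisDecay` renders Lemma 3.6 as printed, the dependence of `C₁` on
  `(C, ‖v‖₃, ‖q‖_{3/2})` included: one function `Φ(C, ∫_Q |v|³, ∫_Q |q|^{3/2})`, chosen before the
  solution, bounds `A + E + C + D` at all printed `(z_b, r)` (the constant of (r4) exposed through
  `IsAxisDecayOnCylWith C u`). It is implied by the uniform-constant rendering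
  `ScaledEnergyBound36` of `SereginSverakBlowupDecay.lean` (`scaledEnergyBoundOfAxisDecay_of_bound36`,
  `SereginSverakAxisDecayProofs.lean`) and thereby discharged
  (`ScaledEnergyBoundOfAxisDecay_holds`, `SereginSverakBlowupAlternativeAssembly.lean`).
* Where the uniformity of Lemma 3.6 is load-bearing. Step (iv) of §4 consumes the functionals
  `A, E, C, D` at the MOVING blow-up centres `(x_{3k} e₃, t_k)`, `t_k ↑ 0`, not only at the origin
  as (p1) is printed; under (r2) + (r4) the bounds there come from Lemma 3.6 applied to the
  time-shifted zooms `μ v(μ x, t_k + μ² t)`, `μ² q(…)` of the solution — which again satisfy the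
  hypotheses of Thm. 3.2 in `Q` with the SAME constant `C` in (r4) and with norms controlled by `μ`
  and the norms of `(v, q)` — together with the uniformity of `C₁` (part of the printed "scaling
  arguments"). This bookkeeping belongs to the DISCHARGE of `BlowupAlternative`
  (`blowup_of_decay`, `blowupAlternative_of_facts` of `SereginSverakBlowupDecay.lean`, which use
  `ScaledEnergyBound36`), not to the assembly of Thm. 3.2, which needs Lemma 3.6 at the origin only.
* History. Until 2026-08-15 this file also carried a separate named fact for the blow-up step of
  Thm. 3.2 with `ScaledEnergyBoundOfAxisDecay` as antecedent; it was merged back into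
  `BlowupAlternative` (its consequent is a corollary of `BlowupAlternative` by the bookkeeping
  above, and an arbitrary `Φ` gives no control along the blow-up sequence, so the antecedent was
  not load-bearing: `SereginSverakAxisDecayProofs.lean`, module docstring).

## Rendering choices

* (r4) is the junk-free a.e. form `|x'| ‖u(t,x)‖ ≤ C` on `Q` (vacuous on the axis, as in print);
  `∃ C : ℝ` versus the printed "positive constant" is immaterial (a bound with `C ≤ 0` forces
  `u = 0` a.e., a solution).
* Lemma 3.6: `C₁ = Φ C I₃ I_{3/2}` with `I₃ = ∫⁻_Q ‖u‖ₑ³`, `I_{3/2} = ∫⁻_Q ‖p‖ₑ^{3/2}` (finite by the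
  standing assumptions; `Φ` is `ℝ≥0`-valued so the bound is finite). Monotonicity/continuity of
  `Φ` is not printed and not assumed. `E` is computed through a weak spatial gradient `G = ∇v` on
  `Q` provided by the fact (Remark 3.4), as in `ScaledEnergyBound`.
* Not here: the discharge of Lemma 3.6 (the bootstrap (as8)/(as11)–(as13) with Lemma 3.3 and
  Remark 3.4: `ScaledEnergyBound36_holds`, `SereginSverakBlowupDecayProofs.lean`), the discharge of
  `BlowupAlternative` (§4 proper), Thm. 1.2 (the general-cylinder form of Thm. 3.2, "obtained by
  re-scaling"), Thm. 1.3.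

## References

* G. Seregin, V. Šverák, Comm. PDE 34 (2009), 171–201, arXiv:0804.1803: §3 p. 9 (Thm. 3.2 (rt2),
  (r2), (r4), Lemma 3.5 (as4)–(as5)), p. 10 (Lemma 3.6 (asl5)), §4 p. 11 ((p1)–(p11)).
  [`SereginSverak2009`]
* G. Koch, N. Nadirashvili, G. Seregin, V. Šverák, Acta Math. 203 (2009), 83–105, Thm. 5.3.
  [`KochNadirashviliSereginSverak2009`]
-/

noncomputable section

open MeasureTheory Set Function Filter Topology TopologicalSpace
open scoped NNReal ENNReal

namespace Literature.Analysis.FluidPDE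

namespace SereginSverak2009

/-- Local notation for physical space `ℝ³ = EuclideanSpace ℝ (Fin 3)`. -/
local notation "ℝ³" => EuclideanSpace ℝ (Fin 3)

/-! ### Hypothesis (r4) -/

/-- Hypothesis (r4) of Thm. 3.2 with its constant exposed: `|v(x,t)| ≤ C/|x'|` for a.e.
`z = (x,t) ∈ Q`, in the junk-free form `|x'| ‖u(t,x)‖ ≤ C` a.e. on `Q = Q(0, 1)`.
[cite: SereginSverak2009, Thm. 3.2 (r4)] -/
def IsAxisDecayOnCylWith (C : ℝ) (u : ℝ → ℝ³ → ℝ³) : Prop :=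
  ∀ᵐ z ∂(volume.restrict (parCyl 0 1)), cylRadius z.2 * ‖u z.1 z.2‖ ≤ C

/-- Hypothesis (r4) of Thm. 3.2: `|x'| ‖u‖ ≤ C` a.e. on `Q` for some constant `C`.
[cite: SereginSverak2009, Thm. 3.2 (r4)] -/
def IsAxisDecayOnCyl (u : ℝ → ℝ³ → ℝ³) : Prop :=
  ∃ C : ℝ, IsAxisDecayOnCylWith C u

/-- (r4) restricted to a smaller cylinder `Q(ρ)`, `0 ≤ ρ ≤ 1` (the local (p2) consumed by
`BlowupAlternative`). [folklore] -/
theorem IsAxisDecayOnCylWith.restrict {C : ℝ} {u : ℝ → ℝ³ → ℝ³} (h : IsAxisDecayOnCylWith C u)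
    {ρ : ℝ} (hρ : 0 ≤ ρ) (hρ1 : ρ ≤ 1) :
    ∀ᵐ z ∂(volume.restrict (parCyl 0 ρ)), cylRadius z.2 * ‖u z.1 z.2‖ ≤ C :=
  ae_restrict_of_ae_restrict_of_subset (parCyl_mono 0 hρ hρ1) h

/-! ### Lemma 3.6, with its uniformity -/

/-- **Seregin–Šverák 2009, Lemma 3.6** (arXiv p. 10: "Under assumptions of Theorem 3.2, estimate
(as4) is valid as well with constant `C₁` depending only on the constant `C` in (r4),
`‖v‖_{L₃(Q)}`, and `‖q‖_{L_{3/2}(Q)}`"), uniformity included: there is ONE function `Φ` of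
`(C, ∫_Q |v|³, ∫_Q |q|^{3/2})` such that for every pair `(u, p)` satisfying the standing
assumptions of §3 with axial symmetry, (r2) and (r4) with constant `C`, there is a weak spatial
gradient `G = ∇u ∈ L²_loc(Q)` (Remark 3.4) with
`A(z_b,r;u) + E(z_b,r;u) + C(z_b,r;u) + D(z_b,r;p) ≤ Φ(C, ∫_Q|u|³, ∫_Q|p|^{3/2})` for all
`z_b = (b e₃, 0)`, `|b| ≤ 1/4`, `0 < r < 1/4`. (The uniformity is what the "scaling arguments" of
§4 use for Thm. 3.2: the lemma is applied to time-shifted zooms of one solution; module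
docstring.) [cite: SereginSverak2009, Lemma 3.6 with Lemma 3.5 (as4)–(as5) and Remark 3.4] -/
def ScaledEnergyBoundOfAxisDecay : Prop :=
  ∃ Φ : ℝ → ℝ≥0∞ → ℝ≥0∞ → ℝ≥0,
    ∀ (u : ℝ → ℝ³ → ℝ³) (p : ℝ → ℝ³ → ℝ) (C : ℝ), IsAxisymmetricLocalSolution u p →
      IsBoundedAwayFromZero u → IsAxisDecayOnCylWith C u →
      ∃ G : ℝ → ℝ³ → ℝ³ →L[ℝ] ℝ³, HasWeakSpatialGradientOn (parCylOpens 0 1) u G ∧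
        ∀ b : ℝ, |b| ≤ 1 / 4 → ∀ r ∈ Ioo (0 : ℝ) (1 / 4),
          energyA ((0 : ℝ), b • eZ) r u + dissipationE ((0 : ℝ), b • eZ) r G +
              cubicC ((0 : ℝ), b • eZ) r u + pressureD ((0 : ℝ), b • eZ) r p ≤
            Φ C (∫⁻ z in parCyl 0 1, ‖u z.1 z.2‖ₑ ^ (3 : ℕ))
              (∫⁻ z in parCyl 0 1, ‖p z.1 z.2‖ₑ ^ (3 / 2 : ℝ))

/-! ### Theorem 3.2, assembled -/

/-- **Seregin–Šverák 2009, Theorem 3.2, assembled as in §4** (arXiv p. 11: "Using Lemmata 3.3,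
3.5, 3.6, Remark 3.4, Proposition 3.7 and scaling arguments, we may assume (p1), (p2)" … "such a
solution must be identically zero. But this contradicts (p11)") from Lemma 3.6
(`ScaledEnergyBoundOfAxisDecay`), the blow-up alternative of §4 (`BlowupAlternative` of the parent
file) and KNSS 2009, Thm. 5.3 (`KNSS2009_liouville_bound_C_over_r`): an axially symmetric
distributional solution in `Q` with `u ∈ L³(Q)`, `p ∈ L^{3/2}(Q)`, `u ∈ L_∞(𝒞 × ]-1,-a²[)` for
every `0 < a < 1` and `|u| ≤ C/|x'|` a.e. in `Q` is regular at the origin. Lemma 3.6 at `z_b = 0`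
gives the origin-centred local (p1) of `BlowupAlternative` on `]0, 1/8]`, and (r4) is its local
(p2) on `Q(1)`. [cite: SereginSverak2009, Thm. 3.2 and §4] -/
theorem isRegularAtOrigin_of_axisDecay (h36 : ScaledEnergyBoundOfAxisDecay)
    (h4 : BlowupAlternative) (h53 : KNSS2009_liouville_bound_C_over_r)
    {u : ℝ → ℝ³ → ℝ³} {p : ℝ → ℝ³ → ℝ} (hsol : IsAxisymmetricLocalSolution u p)
    (hb : IsBoundedAwayFromZero u) (hd : IsAxisDecayOnCyl u) : IsRegularAtOrigin u := by
  by_contra hsing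
  obtain ⟨Φ, hΦ⟩ := h36
  obtain ⟨C, hC⟩ := hd
  obtain ⟨G, hG, hbound⟩ := hΦ u p C hsol hb hC
  -- local (p1) at the origin from Lemma 3.6 at `z_b = 0`
  have hp1 : ∃ G : ℝ → ℝ³ → ℝ³ →L[ℝ] ℝ³, HasWeakSpatialGradientOn (parCylOpens 0 1) u G ∧
      ∃ ρ ∈ Ioc (0 : ℝ) 1, ∃ A₁ : ℝ≥0, ∀ r ∈ Ioc (0 : ℝ) ρ,
        energyA 0 r u + dissipationE 0 r G + cubicC 0 r u + pressureD 0 r p ≤ A₁ := by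
    refine ⟨G, hG, 1 / 8, ⟨by norm_num, by norm_num⟩,
      Φ C (∫⁻ z in parCyl 0 1, ‖u z.1 z.2‖ₑ ^ (3 : ℕ))
        (∫⁻ z in parCyl 0 1, ‖p z.1 z.2‖ₑ ^ (3 / 2 : ℝ)), fun r hr => ?_⟩
    have hr' : r ∈ Ioo (0 : ℝ) (1 / 4) := ⟨hr.1, by linarith [hr.2]⟩
    have key := hbound 0 (by norm_num) r hr'
    simpa only [zero_smul, Prod.mk_zero_zero] using key
  -- local (p2) is (r4) itself
  have hp2 : ∃ ρ ∈ Ioc (0 : ℝ) 1, ∃ A₂ : ℝ,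
      ∀ᵐ z ∂(volume.restrict (parCyl 0 ρ)), cylRadius z.2 * ‖u z.1 z.2‖ ≤ A₂ :=
    ⟨1, ⟨one_pos, le_rfl⟩, C, hC⟩
  obtain ⟨w, hw, haxi, hdecay, hne⟩ := h4 u p hsol hb hp1 hp2 hsing
  exact hne (h53 hw haxi hdecay)

/-- **Theorem 3.2, assembled** — the same statement under the name used by the proofs files
(`SereginSverakAxisDecayProofs.lean`, `SereginSverakBlowupAlternativeAssembly.lean`); an alias of
`isRegularAtOrigin_of_axisDecay`. [cite: SereginSverak2009, Thm. 3.2 and §4] -/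
theorem isRegularAtOrigin_of_axisDecay_of_blowupAlternative (h36 : ScaledEnergyBoundOfAxisDecay)
    (h4 : BlowupAlternative) (h53 : KNSS2009_liouville_bound_C_over_r)
    {u : ℝ → ℝ³ → ℝ³} {p : ℝ → ℝ³ → ℝ} (hsol : IsAxisymmetricLocalSolution u p)
    (hb : IsBoundedAwayFromZero u) (hd : IsAxisDecayOnCyl u) : IsRegularAtOrigin u :=
  isRegularAtOrigin_of_axisDecay h36 h4 h53 hsol hb hd

end SereginSverak2009

end Literature.Analysis.FluidPDE
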